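import Summits.ValiantsHypothesis.ValiantsHypothesis.Theorems.ValuativeGCTValuativeFlipDetEffectiveMonotone

/-!
# Orbit closures of determinants absorb sums of CLOSURE points at polynomial size cost
# (crux `ValuativeGCT.ValuativeFlip`, stmt-ValiantsHypothesis-12624; wall-breaker axis
# "representation-stability transfer `m ↔ m + 1`", k16 gen 1, seat 3; sequel to
# `…DetEffectiveMonotone.lean`)

The det-specific input of the effective padding monotonicity (`…DetEffectiveMonotone.lean`) is that
`Δ(det)` absorbs sums: a sum of `r` forms with affine determinantal expressions of size `m` has one of
size `r·2(m+1)^9 + 1`, hence its padded form lies in `Δ(det_{m+j})` for `m + j` that large.  This file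
upgrades the statement from ORBIT points (`A · det_m`, which have affine expressions) to arbitrary
CLOSURE points of `Δ(det_m)` (border complexity), by Zariski continuity:

* `affine_mem_orbitClosure_of_forall_glOrbit` — **affine maps of forms are Zariski continuous for orbit
  closures**: if `Λ` is `ℂ`-linear, `R` fixed, and `Λ(g · f) + R ∈ Δ(F)` for every `g ∈ GL`, then
  `Λ q + R ∈ Δ(F)` for every `q ∈ Δ(f)` (`f` a form; substitute the affine coefficient map into the
  test polynomials of `mem_orbitClosure_iff`).  General tool (any variables, any target `F`).
* `X_pow_mul_rename_segEmb_mem_orbitClosure_det` — Mulmuley–Sohoni Prop. 4.4 for a level PAIR `m ≤ N`: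
  `HasDetRepr f N ⟹ X_top^{N-m} · ι(f) ∈ Δ(det_N)`.
* `X_pow_mul_rename_sum_smul_mem_orbitClosure_det`, `paddedForm_sum_smul_mem_orbitClosure_det` —
  **polynomial sub-additivity of BORDER determinantal complexity**: if `q_1, …, q_r ∈ Δ(det_m)` and
  `N ≥ r·2(m+1)^9 + 1` (resp. `N = m + j`), then `X_top^{N-m} · ι(Σ_t β_t q_t) ∈ Δ(det_N)` (induction on
  the number of closure arguments, one affine slot at a time).

Sources: Mulmuley–Sohoni 2001 §4 (orbit closures, Prop. 4.4); Bürgisser 2004 Lemma 5.5(3) and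
Valiant 1979 (sums of determinants); folklore (closure of `\underline{VP}`-type classes under addition).
-/

set_option linter.dupNamespace false

namespace Summit.ValiantsHypothesis.ValiantsHypothesis.Theorems.ValuativeFlip

open scoped BigOperators
open MvPolynomial
open Literature.NumberTheory.DiophantineGeometry
open Literature.Computability.AlgebraicComplexity
open Literature.Computability.Complexity

noncomputable section

/-- **Affine maps of forms are Zariski continuous for orbit closures.**  Let `f` be a form of degree
`d`, `Λ` a `ℂ`-linear map of polynomial rings and `R` a fixed polynomial.  If `Λ (g · f) + R ∈ Δ(F)` for
every `g ∈ GL`, then `Λ q + R ∈ Δ(F)` for every `q ∈ Δ(f)`: a test polynomial `p` in the coefficients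
vanishing on `GL · F` vanishes on `Δ(F)`, so `p ∘ (coefficients of Λ · + R)` — a polynomial in the
degree-`d` coefficients, the map being affine on forms of degree `d` — vanishes on `GL · f`, hence at the
closure point `q`. [Mulmuley–Sohoni 2001 §4; folklore] -/
theorem affine_mem_orbitClosure_of_forall_glOrbit {σ τ : Type*} [Fintype σ] [DecidableEq σ]
    [Fintype τ] [DecidableEq τ] {f : MvPolynomial σ ℂ} {d : ℕ} (hf : f.IsHomogeneous d)
    (F : MvPolynomial τ ℂ) (Λ : MvPolynomial σ ℂ →ₗ[ℂ] MvPolynomial τ ℂ) (R : MvPolynomial τ ℂ)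
    (h : ∀ g : GL σ ℂ, Λ (linSubstRep σ ℂ g f) + R ∈ orbitClosure F)
    {q : MvPolynomial σ ℂ} (hq : q ∈ orbitClosure f) : Λ q + R ∈ orbitClosure F := by
  classical
  rw [mem_orbitClosure_iff]
  intro p hp
  -- the affine coefficient map of `q' ↦ Λ q' + R` on forms of degree `d`, as a substitution
  let ℓ : (τ →₀ ℕ) → MvPolynomial (σ →₀ ℕ) ℂ := fun e' =>
    ∑ e : DegIdx σ d, C (coeff e' (Λ (monomial e.1 1))) * X e.1 + C (coeff e' R)
  have hℓ : ∀ q' : MvPolynomial σ ℂ, q'.IsHomogeneous d →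
      ∀ e', aeval (coeffVec q') (ℓ e') = coeff e' (Λ q' + R) := by
    intro q' hq' e'
    simp only [ℓ, map_add, map_sum, map_mul, aeval_C, aeval_X, coeffVec_apply, Algebra.algebraMap_self_apply]
    conv_rhs => rw [← sum_coeff_smul_monomial_eq hq']
    rw [coeff_add, map_sum, coeff_sum]
    refine congrArg (· + coeff e' R) (Finset.sum_congr rfl fun e _ => ?_)
    rw [map_smul, coeff_smul, smul_eq_mul, mul_comm]
  have key : ∀ q' : MvPolynomial σ ℂ, q'.IsHomogeneous d →
      aeval (coeffVec q') (aeval ℓ p) = aeval (coeffVec (Λ q' + R)) p := by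
    intro q' hq'
    rw [← AlgHom.comp_apply, comp_aeval]
    refine congrArg (fun v : (τ →₀ ℕ) → ℂ => aeval v p) (funext fun e' => ?_)
    rw [hℓ q' hq' e', coeffVec_apply]
  rw [← key q (hf.of_mem_orbitClosure hq)]
  refine (mem_orbitClosure_iff.mp hq) (aeval ℓ p) fun h' hh' => ?_
  obtain ⟨g, rfl⟩ := hh'
  have hg : (linSubstRep σ ℂ g f).IsHomogeneous d := by
    rw [linSubstRep_apply]; exact linSubst_isHomogeneous _ hf
  rw [key _ hg]
  exact (mem_orbitClosure_iff.mp (h g)) p hp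

/-- **Level-pair padding of determinantal forms** (Mulmuley–Sohoni Prop. 4.4 with an arbitrary target
level): if a form `f` of degree `m` on `Mat_m` has an affine determinantal expression of size `N ≥ m`, then
`X_top^{N-m} · ι(f) ∈ Δ(det_N)` for the final-segment placement `ι = segEmb`.  (The in-tree
`paddedForm_mem_orbitClosure_detFormLex` is the case `N = m + j`.) [Mulmuley–Sohoni 2001 Prop. 4.4;
Ikenmeyer–Panova 2017 Lemma 2.7] -/
theorem X_pow_mul_rename_segEmb_mem_orbitClosure_det {m N : ℕ} [NeZero N] (hmN : m ≤ N)
    {f : MvPolynomial (MatIdx m) ℂ} (hf : f.IsHomogeneous m) (hA : HasDetRepr f N) :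
    X (topMatIdx N) ^ (N - m) * rename (segEmb hmN) f ∈ orbitClosure (detFormLex ℂ N) := by
  classical
  have hmem := X_pow_mul_rename_mem_endOrbit_detPoly (k := ℂ) hf hmN hA
    (fun x => ofLex (segEmb hmN x)) (ofLex (topMatIdx N))
  have hcl := endOrbit_subset_orbitClosure_holds _ hmem
  have hren : rename (toLex : Fin N × Fin N → MatIdx N)
      (X (ofLex (topMatIdx N)) ^ (N - m) * rename (fun x => ofLex (segEmb hmN x)) f) =
      X (topMatIdx N) ^ (N - m) * rename (segEmb hmN) f := by
    rw [map_mul, map_pow, rename_X, toLex_ofLex, rename_rename]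
    rfl
  rw [← hren, detFormLex]
  exact (rename_mem_orbitClosure_rename_iff_holds toLex (detPoly (Fin N) ℂ) _).2 hcl

/-- **Polynomial sub-additivity of border determinantal complexity** (level-pair form).  If
`q_1, …, q_r ∈ Δ(det_m)` (`m ≥ 1`) and `N ≥ r·2(m+1)^9 + 1`, `N ≥ m`, then for all scalars `β`,
`X_top^{N-m} · ι(Σ_t β_t q_t) ∈ Δ(det_N)`.  Proof: for ORBIT points `q_t = g_t · det_m` the sum has an
affine determinantal expression of size `r·2(m+1)^9 + 1` (`hasDetRepr_sum_of_isHomogeneous`), so its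
padding lies in `Δ(det_N)` (Mulmuley–Sohoni Prop. 4.4); replace the orbit points by closure points one
slot at a time (`affine_mem_orbitClosure_of_forall_glOrbit`, the other slots frozen).
[Mulmuley–Sohoni 2001 Prop. 4.4; Bürgisser 2004 Lemma 5.5(3); folklore] -/
theorem X_pow_mul_rename_sum_smul_mem_orbitClosure_det {m N : ℕ} [NeZero m] [NeZero N] (hmN : m ≤ N)
    {r : ℕ} (q : Fin r → MvPolynomial (MatIdx m) ℂ)
    (hq : ∀ t, q t ∈ orbitClosure (detFormLex ℂ m)) (β : Fin r → ℂ)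
    (hN : r * (2 * (m + 1) ^ 9) + 1 ≤ N) :
    X (topMatIdx N) ^ (N - m) * rename (segEmb hmN) (∑ t, β t • q t) ∈ orbitClosure (detFormLex ℂ N) := by
  classical
  have hm : 1 ≤ m := Nat.one_le_iff_ne_zero.mpr (NeZero.ne m)
  have hdet := detFormLex_isHomogeneous ℂ m
  -- induction on the number `k` of slots allowed to be closure points (the others are orbit points)
  suffices H : ∀ k : ℕ, k ≤ r → ∀ q' : Fin r → MvPolynomial (MatIdx m) ℂ,
      (∀ t : Fin r, (t : ℕ) < k → q' t ∈ orbitClosure (detFormLex ℂ m)) →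
      (∀ t : Fin r, k ≤ (t : ℕ) → ∃ g : GL (MatIdx m) ℂ, q' t = linSubstRep (MatIdx m) ℂ g (detFormLex ℂ m)) →
      X (topMatIdx N) ^ (N - m) * rename (segEmb hmN) (∑ t, β t • q' t) ∈ orbitClosure (detFormLex ℂ N) by
    exact H r le_rfl q (fun t _ => hq t) (fun t ht => absurd t.2 (not_lt.mpr ht))
  intro k
  induction k with
  | zero =>
    intro _ q' _ horb
    choose g hg using fun t : Fin r => horb t (Nat.zero_le _)
    -- all slots are orbit points: an affine determinantal expression of the sum
    have hsum := Summit.ValiantsHypothesis.ValiantsHypothesis.Theorems.BorderApolarityFixedWitnessObstructionQP.hasDetRepr_sum_of_isHomogeneous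
      (Finset.univ : Finset (Fin r)) (fun t => β t • q' t) m m
      (fun t _ => by
        rw [hg t, linSubstRep_apply, smul_eq_C_mul]
        exact (linSubst_isHomogeneous _ hdet).C_mul _)
      (fun t _ => by
        rw [hg t, linSubstRep_apply]
        exact hasDetRepr_smul hm _ (hasDetRepr_linSubst _ (hasDetRepr_detFormLex m)))
    rw [Finset.card_univ, Fintype.card_fin] at hsum
    have hhom : (∑ t, β t • q' t).IsHomogeneous m := by
      refine IsHomogeneous.sum _ _ _ fun t _ => ?_
      rw [hg t, linSubstRep_apply, smul_eq_C_mul]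
      exact (linSubst_isHomogeneous _ hdet).C_mul _
    exact X_pow_mul_rename_segEmb_mem_orbitClosure_det hmN hhom (HasDetRepr.mono_holds hsum hN)
  | succ k ih =>
    intro hk q' hcl horb
    have hkr : k < r := hk
    set t₀ : Fin r := ⟨k, hkr⟩ with ht₀
    -- freeze the slots `≠ t₀`; the slot `t₀` enters affinely
    set Rest : MvPolynomial (MatIdx m) ℂ := ∑ t ∈ Finset.univ.erase t₀, β t • q' t with hRest
    have hsplit : ∀ x : MvPolynomial (MatIdx m) ℂ,
        ∑ t, β t • Function.update q' t₀ x t = β t₀ • x + Rest := by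
      intro x
      rw [← Finset.add_sum_erase _ _ (Finset.mem_univ t₀), Function.update_self]
      refine congrArg (β t₀ • x + ·) (Finset.sum_congr rfl fun t ht => ?_)
      rw [Function.update_of_ne (Finset.ne_of_mem_erase ht)]
    set pad : MvPolynomial (MatIdx m) ℂ →ₗ[ℂ] MvPolynomial (MatIdx N) ℂ :=
      (LinearMap.mulLeft ℂ (X (topMatIdx N) ^ (N - m))).comp (rename (segEmb hmN)).toLinearMap with hpad
    have hpad_apply : ∀ x, pad x = X (topMatIdx N) ^ (N - m) * rename (segEmb hmN) x := fun x => rfl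
    have hΛ : ∀ x, (β t₀ • pad) x + pad Rest =
        X (topMatIdx N) ^ (N - m) * rename (segEmb hmN) (∑ t, β t • Function.update q' t₀ x t) := by
      intro x
      rw [hsplit, LinearMap.smul_apply, ← map_smul, ← map_add, hpad_apply]
    -- the hypothesis of the continuity lemma: orbit points in slot `t₀` (induction hypothesis)
    have hGL : ∀ g : GL (MatIdx m) ℂ,
        (β t₀ • pad) (linSubstRep (MatIdx m) ℂ g (detFormLex ℂ m)) + pad Rest ∈
          orbitClosure (detFormLex ℂ N) := by
      intro g
      rw [hΛ]
      refine ih (Nat.le_of_succ_le hk) _ (fun t ht => ?_) (fun t ht => ?_)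
      · have hne : t ≠ t₀ := fun h => by rw [h] at ht; exact lt_irrefl _ ht
        rw [Function.update_of_ne hne]
        exact hcl t (Nat.lt_succ_of_lt ht)
      · by_cases hte : t = t₀
        · subst hte
          exact ⟨g, Function.update_self _ _ _⟩
        · rw [Function.update_of_ne hte]
          refine horb t ?_
          have : (t : ℕ) ≠ k := fun h => hte (Fin.ext h)
          omega
    -- conclude at the closure point in slot `t₀`
    have hmem := affine_mem_orbitClosure_of_forall_glOrbit hdet (detFormLex ℂ N) (β t₀ • pad)
      (pad Rest) hGL (hcl t₀ (Nat.lt_succ_self k))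
    rw [hΛ, Function.update_eq_self] at hmem
    exact hmem

/-- **Polynomial sub-additivity of border determinantal complexity** (padded-form version): if
`q_1, …, q_r ∈ Δ(det_m)` and `m + j ≥ r·2(m+1)^9 + 1`, then `X_top^j · ι(Σ_t β_t q_t) ∈ Δ(det_{m+j})`
(`paddedForm m j`). [Mulmuley–Sohoni 2001 Prop. 4.4; folklore] -/
theorem paddedForm_sum_smul_mem_orbitClosure_det {m : ℕ} [NeZero m] (j : ℕ) [NeZero (m + j)]
    {r : ℕ} (q : Fin r → MvPolynomial (MatIdx m) ℂ)
    (hq : ∀ t, q t ∈ orbitClosure (detFormLex ℂ m)) (β : Fin r → ℂ)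
    (hj : r * (2 * (m + 1) ^ 9) + 1 ≤ m + j) :
    paddedForm m j (∑ t, β t • q t) ∈ orbitClosure (detFormLex ℂ (m + j)) := by
  have h := X_pow_mul_rename_sum_smul_mem_orbitClosure_det (Nat.le_add_right m j) q hq β hj
  rwa [Nat.add_sub_cancel_left] at h

end

end Summit.ValiantsHypothesis.ValiantsHypothesis.Theorems.ValuativeFlip
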